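import Summits.QuantumAdvantage.QuantumAdvantage.Theorems.CubicForrelationNearExactIsExactAmmCeilingW

/-!
# Crux `CubicForrelation.NearExactIsExact` (stmt-QuantumAdvantage-14043) — almost-MM ceiling, part Z:
the fibre decomposition of `Φ`, the bound `K·|Z| ≤ 2^{2a+3}(1 − Φ)`, and periodicity in type (a)

Line `direct-sum-amplification`, lead c3 (fifth helper file for the registered stub `stub_ammCeiling`).
Notation as in parts Q–W; `K = 2^{a+2}`, `T′_{x₁}(y) = (−1)^{h y} W_{c_{x₁}}(y)`, fibre `φ⁻¹(x₁)`,
`Γ(x₁) = Σ_{y ∈ φ⁻¹(x₁)} T′_{x₁}(y)`, zero locus `Z = {x₁ : B(x₁) = 0}`.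
* `acz_sum_fibrewise`: `Σ_y (−1)^{h y} W_{c_{φ y}}(y) = Σ_{x₁} Γ(x₁)`.
* `acz_gamma_total_le`: with Plücker everywhere and quadratic slices, `Σ_{x₁} Γ(x₁) ≤ 2K·2^a − K·|Z|`
  (`Γ ≤ 2K` off `Z`, `Γ ≤ K` on `Z`, parts Y).
* `acz_periodic`: in type (a) of the rank-two pencil (a non-zero `w` in every row space) and with every corner in
  its fibre, the degree-`≤ 1` functions `y ↦ φ(y ⊕ w)_i ⊕ φ(y)_i` vanish on all corner sets, i.e. off at most `4|Z|`
  points, hence identically once `2|Z| < 2^a`: `φ` is `w`-periodic.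

References: S. Kudin, E. Pasalic, A. Polujan, F. Zhang, *Almost Maiorana-McFarland bent functions*,
arXiv:2508.14265 (IEEE TIT 2025), Prop. 4.1; C. Carlet, *Boolean Functions for Cryptography and Coding Theory*
(CUP 2021), §5.1.
-/

set_option linter.dupNamespace false -- D-0017: single-problem summit ⇒ `QuantumAdvantage.QuantumAdvantage` by design

noncomputable section

namespace Summit.QuantumAdvantage.QuantumAdvantage.Theorems.CubicForrelation.NearExactIsExact

open Finset
open Literature.Computability.QuantumComplexity
open Literature.Computability.QuantumComplexity.BuzetChailloux (bxor zeroVec signOf_sq bxor_zeroVec zeroVec_bxor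
  bxor_comm bxor_self bxor_bxor_cancel_left twist_zeroVec_right twist_bxor_right sum_twist_left bxor_eq_zeroVec_iff)
open Literature.Computability.QuantumComplexity.DerivativeWalsh (W signOf_not)

variable {a : ℕ}

/-! ### The fibre decomposition of the forrelation sum -/

/-- `Σ_y (−1)^{h y} W_{c_{φ y}}(y) = Σ_{x₁} Σ_{y ∈ φ⁻¹(x₁)} (−1)^{h y} W_{c_{x₁}}(y)` (group the sum by fibres). [folklore] -/
theorem acz_sum_fibrewise (f : (Fin (a + (a + 2)) → Bool) → Bool) (φ : (Fin (a + 2) → Bool) → (Fin a → Bool))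
    (h : (Fin (a + 2) → Bool) → Bool) :
    ∑ y : Fin (a + 2) → Bool, signOf (h y) * W (fun x₂ => signOf (f (Fin.append (φ y) x₂))) y =
      ∑ x₁ : Fin a → Bool, ∑ y ∈ univ.filter (fun y : Fin (a + 2) → Bool => φ y = x₁),
        signOf (h y) * W (fun x₂ => signOf (f (Fin.append x₁ x₂))) y := by
  rw [← sum_fiberwise_of_maps_to (g := φ) (fun y _ => mem_univ (φ y))]
  refine sum_congr rfl fun x₁ _ => sum_congr rfl fun y hy => ?_
  rw [(mem_filter.1 hy).2]

/-! ### The total fibre sum: `Σ Γ ≤ 2K·2^a − K·|Z|` -/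

/-- **Total fibre sum.** If all slices are quadratic and Plücker holds everywhere, then
`Σ_{x₁} Γ(x₁) ≤ 2·2^{a+2}·2^a − 2^{a+2}·|Z|` with `Z = {x₁ : B(x₁) = 0}` (`Γ ≤ 2K` off `Z`, `≤ K` on `Z`). -/
theorem acz_gamma_total_le (l : (Fin (a + 2) → Bool) → (Fin (a + 2) → Bool) → Bool) (hl : ∀ y x, signOf (l y x) = twist x y)
    {f : (Fin (a + (a + 2)) → Bool) → Bool} (φ : (Fin (a + 2) → Bool) → (Fin a → Bool)) (h : (Fin (a + 2) → Bool) → Bool)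
    (B : (Fin a → Bool) → Fin (a + 2) → Fin (a + 2) → Bool)
    (hB : ∀ x₁ i j, B x₁ i j = (f (Fin.append x₁ zeroVec) ^^ f (Fin.append x₁ (Pi.single i true)) ^^
      f (Fin.append x₁ (Pi.single j true)) ^^ f (Fin.append x₁ (bxor (Pi.single i true) (Pi.single j true)))))
    (hPl : ∀ x₁ i j i' j', ((B x₁ i j && B x₁ i' j') ^^ (B x₁ i i' && B x₁ j j') ^^ (B x₁ i j' && B x₁ j i')) = false)
    (hq : ∀ x₁, IsDegLeFun 2 (fun x₂ : Fin (a + 2) → Bool => f (Fin.append x₁ x₂))) :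
    ∑ x₁ : Fin a → Bool, ∑ y ∈ univ.filter (fun y : Fin (a + 2) → Bool => φ y = x₁),
        signOf (h y) * W (fun x₂ => signOf (f (Fin.append x₁ x₂))) y ≤
      2 * (2 : ℝ) ^ (a + 2) * (2 : ℝ) ^ a -
        (2 : ℝ) ^ (a + 2) * ((univ.filter fun x₁ : Fin a → Bool => ∀ i j, B x₁ i j = false).card : ℝ) := by
  set Z := univ.filter (fun x₁ : Fin a → Bool => ∀ i j, B x₁ i j = false) with hZ
  set Γ : (Fin a → Bool) → ℝ := fun x₁ => ∑ y ∈ univ.filter (fun y : Fin (a + 2) → Bool => φ y = x₁),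
    signOf (h y) * W (fun x₂ => signOf (f (Fin.append x₁ x₂))) y with hΓ
  have hσ : ∀ y, |signOf (h y)| = 1 := fun y => abs_signOf _
  have onZ : ∀ x₁ ∈ Z, Γ x₁ ≤ (2 : ℝ) ^ (a + 2) := fun x₁ hx =>
    acy_gamma_zero l (B x₁) hl (hq x₁) (hB x₁) (mem_filter.1 hx).2
      (univ.filter fun y : Fin (a + 2) → Bool => φ y = x₁) (fun y => signOf (h y)) hσ
  have offZ : ∀ x₁ ∈ univ.filter (fun x₁ : Fin a → Bool => ¬ ∀ i j, B x₁ i j = false),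
      Γ x₁ ≤ 2 * (2 : ℝ) ^ (a + 2) := by
    intro x₁ hx
    have hx' := (mem_filter.1 hx).2
    push Not at hx'
    obtain ⟨p, q, hpq⟩ := hx'
    have hpq' : B x₁ p q = true := by revert hpq; cases B x₁ p q <;> simp
    have key := acy_gamma_rankTwo l (B x₁) hl (hq x₁) (hB x₁) (hPl x₁) hpq'
      (univ.filter fun y : Fin (a + 2) → Bool => φ y = x₁) (fun y => signOf (h y)) hσ
    show Γ x₁ ≤ _
    linarith
  have split : ∑ x₁ ∈ Z, Γ x₁ + ∑ x₁ ∈ univ.filter (fun x₁ : Fin a → Bool => ¬ ∀ i j, B x₁ i j = false), Γ x₁ =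
      ∑ x₁, Γ x₁ := sum_filter_add_sum_filter_not _ _ _
  have hcZ : ((univ.filter fun x₁ : Fin a → Bool => ¬ ∀ i j, B x₁ i j = false).card : ℝ) = (2 : ℝ) ^ a - Z.card := by
    have e := Finset.card_filter_add_card_filter_not (s := (univ : Finset (Fin a → Bool)))
      (fun x₁ : Fin a → Bool => ∀ i j, B x₁ i j = false)
    rw [card_univ, Fintype.card_fun, Fintype.card_bool, Fintype.card_fin] at e
    have e' : (Z.card : ℝ) + ((univ.filter fun x₁ : Fin a → Bool => ¬ ∀ i j, B x₁ i j = false).card : ℝ) = (2 : ℝ) ^ a := by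
      exact_mod_cast e
    linarith
  have b1 : ∑ x₁ ∈ Z, Γ x₁ ≤ Z.card * (2 : ℝ) ^ (a + 2) := by
    have := sum_le_sum onZ
    rwa [sum_const, nsmul_eq_mul] at this
  have b2 : ∑ x₁ ∈ univ.filter (fun x₁ : Fin a → Bool => ¬ ∀ i j, B x₁ i j = false), Γ x₁ ≤
      ((2 : ℝ) ^ a - Z.card) * (2 * (2 : ℝ) ^ (a + 2)) := by
    have := sum_le_sum offZ
    rwa [sum_const, nsmul_eq_mul, hcZ] at this
  show ∑ x₁, Γ x₁ ≤ _
  rw [← split]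
  nlinarith [b1, b2]

/-! ### Type (a): a common row vector makes `φ` periodic -/

/-- In 𝔽₂, a sum of products with a fixed row splits along the Plücker relation: with `B_{pq} = 1`,
`Σ_i s_i B_{il} = (Σ_i s_i B_{ip}) B_{ql} + (Σ_i s_i B_{iq}) B_{pl}`. [folklore] -/
theorem acz_row_combination {k : ℕ} (B : Fin k → Fin k → Bool)
    (hP : ∀ i j i' j', ((B i j && B i' j') ^^ (B i i' && B j j') ^^ (B i j' && B j i')) = false)
    (hsymm : ∀ i j, B i j = B j i) {p q : Fin k} (hpq : B p q = true) (s : Fin k → Bool) (l' : Fin k) :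
    (∑ i, (if s i then (1 : ZMod 2) else 0) * (if B i l' then (1 : ZMod 2) else 0)) =
      (∑ i, (if s i then (1 : ZMod 2) else 0) * (if B i p then (1 : ZMod 2) else 0)) * (if B q l' then 1 else 0) +
      (∑ i, (if s i then (1 : ZMod 2) else 0) * (if B i q then (1 : ZMod 2) else 0)) * (if B p l' then 1 else 0) := by
  rw [sum_mul, sum_mul, ← sum_add_distrib]
  refine sum_congr rfl fun i _ => ?_
  have key := hP p q i l'
  rw [hpq, hsymm p i, hsymm q i] at key
  -- key : Plücker at (p,q,i,l') with B p q = 1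
  revert key
  cases s i <;> cases B i l' <;> cases B i p <;> cases B q l' <;> cases B p l' <;> cases B i q <;> decide

/-- **Periodicity in type (a).** Suppose every corner lies in its fibre, a non-zero `w` lies in the row space of
`B(x₁)` for every `x₁ ∉ Z`, `φ` is coordinatewise quadratic and `2|Z| < 2^a`.  Then `φ(y ⊕ w) = φ(y)` for all `y`. -/
theorem acz_periodic
    {f : (Fin (a + (a + 2)) → Bool) → Bool} (φ : (Fin (a + 2) → Bool) → (Fin a → Bool))
    (hφ : ∀ i, IsDegLeFun 2 (fun y => φ y i))
    (B : (Fin a → Bool) → Fin (a + 2) → Fin (a + 2) → Bool)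
    (hB : ∀ x₁ i j, B x₁ i j = (f (Fin.append x₁ zeroVec) ^^ f (Fin.append x₁ (Pi.single i true)) ^^
      f (Fin.append x₁ (Pi.single j true)) ^^ f (Fin.append x₁ (bxor (Pi.single i true) (Pi.single j true)))))
    (d : (Fin a → Bool) → Fin (a + 2) → Bool)
    (hPl : ∀ x₁ i j i' j', ((B x₁ i j && B x₁ i' j') ^^ (B x₁ i i' && B x₁ j j') ^^ (B x₁ i j' && B x₁ j i')) = false)
    (hcm : ∀ (x₁ : Fin a → Bool) (p q : Fin (a + 2)), B x₁ p q = true → ∀ σ τ : Bool,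
      φ (fun j => (d x₁ j ^^ (B x₁ p j && B x₁ q j)) ^^ (σ && B x₁ p j) ^^ (τ && B x₁ q j)) = x₁)
    (w : Fin (a + 2) → Bool)
    (hw : ∀ x, (∃ i j, B x i j = true) → ∃ s : Fin (a + 2) → Bool, ∀ l', (if w l' then (1 : ZMod 2) else 0) =
      ∑ i, (if s i then (1 : ZMod 2) else 0) * (if B x i l' then (1 : ZMod 2) else 0))
    (hZ : (univ.filter fun x₁ : Fin a → Bool => ∀ i j, B x₁ i j = false).card * 2 < 2 ^ a) :
    ∀ y, φ (bxor y w) = φ y := by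
  classical
  have hBsymm : ∀ x i j, B x i j = B x j i := fun x i j => by
    rw [hB, hB, bxor_comm (Pi.single i true)]
    cases f (Fin.append x zeroVec) <;> cases f (Fin.append x (Pi.single i true)) <;> cases f (Fin.append x (Pi.single j true)) <;>
      cases f (Fin.append x (bxor (Pi.single j true) (Pi.single i true))) <;> decide
  have hBdiag : ∀ x i, B x i i = false := fun x i => by
    rw [hB, bxor_self]; cases f (Fin.append x zeroVec) <;> cases f (Fin.append x (Pi.single i true)) <;> decide
  -- (1) for x ∉ Z with B x p q = 1: w = α r_p ⊕ β r_q
  have hw_rows : ∀ x p q, B x p q = true → ∃ α β : Bool, w = fun j => (α && B x p j) ^^ (β && B x q j) := by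
    intro x p q hpq
    obtain ⟨s, hs⟩ := hw x ⟨p, q, hpq⟩
    have dich : ∀ z : ZMod 2, z = 0 ∨ z = 1 := by decide
    set α := ∑ i, (if s i then (1 : ZMod 2) else 0) * (if B x i p then (1 : ZMod 2) else 0) with hα
    set β := ∑ i, (if s i then (1 : ZMod 2) else 0) * (if B x i q then (1 : ZMod 2) else 0) with hβ
    refine ⟨decide (β = 1), decide (α = 1), funext fun l' => ?_⟩
    have key := hs l'
    rw [acz_row_combination (B x) (hPl x) (hBsymm x) hpq s l'] at key
    rw [← hα, ← hβ] at key
    rcases dich α with ha | ha <;> rcases dich β with hb | hb <;> rw [ha, hb] at key ⊢ <;>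
      revert key <;> cases w l' <;> cases B x p l' <;> cases B x q l' <;> decide
  -- (2) Λ_i y := φ (y ⊕ w) i ⊕ φ y i vanishes on every corner
  have hΛcorner : ∀ x p q, B x p q = true → ∀ σ τ : Bool,
      φ (bxor (fun j => (d x j ^^ (B x p j && B x q j)) ^^ (σ && B x p j) ^^ (τ && B x q j)) w) =
        φ (fun j => (d x j ^^ (B x p j && B x q j)) ^^ (σ && B x p j) ^^ (τ && B x q j)) := by
    intro x p q hpq σ τ
    obtain ⟨α, β, hwab⟩ := hw_rows x p q hpq
    have e : bxor (fun j => (d x j ^^ (B x p j && B x q j)) ^^ (σ && B x p j) ^^ (τ && B x q j)) w =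
        fun j => (d x j ^^ (B x p j && B x q j)) ^^ ((σ ^^ α) && B x p j) ^^ ((τ ^^ β) && B x q j) := by
      funext j
      rw [hwab]
      simp only [bxor]
      cases d x j <;> cases B x p j <;> cases B x q j <;> cases σ <;> cases τ <;> cases α <;> cases β <;> decide
    rw [e, hcm x p q hpq, hcm x p q hpq]
  -- (3) counting: the corner sets C x (x ∉ Z) are pairwise disjoint, have ≥ 4 elements, and Λ vanishes on them
  set Z := univ.filter (fun x₁ : Fin a → Bool => ∀ i j, B x₁ i j = false) with hZdef
  set C : (Fin a → Bool) → Finset (Fin (a + 2) → Bool) := fun x => univ.filter fun y =>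
    ∃ p q : Fin (a + 2), ∃ σ τ : Bool, B x p q = true ∧
      y = fun j => (d x j ^^ (B x p j && B x q j)) ^^ (σ && B x p j) ^^ (τ && B x q j) with hC
  have hCfib : ∀ x, ∀ y ∈ C x, φ y = x := by
    intro x y hy
    obtain ⟨p, q, σ, τ, hpq, rfl⟩ := (mem_filter.1 hy).2
    exact hcm x p q hpq σ τ
  have hCcard : ∀ x ∈ univ.filter (fun x₁ : Fin a → Bool => ¬ ∀ i j, B x₁ i j = false), 4 ≤ (C x).card := by
    intro x hx
    have hx' := (mem_filter.1 hx).2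
    push Not at hx'
    obtain ⟨p, q, hpq⟩ := hx'
    have hpq' : B x p q = true := by revert hpq; cases B x p q <;> simp
    -- the four corners are distinct (rows independent)
    have hu : ∃ j, B x p j = true := ⟨q, hpq'⟩
    have hv : ∃ j, B x q j = true := ⟨p, by rw [hBsymm]; exact hpq'⟩
    set cr : Bool → Bool → (Fin (a + 2) → Bool) := fun σ τ j =>
      (d x j ^^ (B x p j && B x q j)) ^^ (σ && B x p j) ^^ (τ && B x q j) with hcr
    have hmem : ∀ σ τ, cr σ τ ∈ C x := fun σ τ => mem_filter.2 ⟨mem_univ _, p, q, σ, τ, hpq', rfl⟩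
    have hne : ∀ σ τ σ' τ', cr σ τ = cr σ' τ' → σ = σ' ∧ τ = τ' := by
      intro σ τ σ' τ' e
      have ep := congrFun e p
      have eq := congrFun e q
      simp only [hcr, hBdiag x p, hBdiag x q, hBsymm x q p, hpq'] at ep eq
      revert ep eq
      cases σ <;> cases τ <;> cases σ' <;> cases τ' <;> cases d x p <;> cases d x q <;> simp
    have hinj : Function.Injective (fun st : Bool × Bool => cr st.1 st.2) := by
      rintro ⟨σ, τ⟩ ⟨σ', τ'⟩ e
      obtain ⟨h1, h2⟩ := hne σ τ σ' τ' e
      rw [h1, h2]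
    have hsub : (univ.image fun st : Bool × Bool => cr st.1 st.2) ⊆ C x :=
      image_subset_iff.2 fun st _ => hmem st.1 st.2
    have h4 : (univ.image fun st : Bool × Bool => cr st.1 st.2).card = 4 := by
      rw [card_image_of_injective _ hinj, card_univ, Fintype.card_prod, Fintype.card_bool]
    rw [← h4]
    exact card_le_card hsub
  set U := (univ.filter (fun x₁ : Fin a → Bool => ¬ ∀ i j, B x₁ i j = false)).biUnion C with hU
  have hUcard : 4 * (2 ^ a - Z.card) ≤ U.card := by
    rw [hU, card_biUnion]
    · have e := Finset.card_filter_add_card_filter_not (s := (univ : Finset (Fin a → Bool)))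
        (fun x₁ : Fin a → Bool => ∀ i j, B x₁ i j = false)
      rw [card_univ, Fintype.card_fun, Fintype.card_bool, Fintype.card_fin] at e
      have := sum_le_sum hCcard
      rw [sum_const, smul_eq_mul] at this
      rw [← hZdef] at e
      have ec : (univ.filter (fun x₁ : Fin a → Bool => ¬ ∀ i j, B x₁ i j = false)).card = 2 ^ a - Z.card := by omega
      rw [ec, mul_comm] at this
      exact this
    · intro x hx x' hx' hxx'
      rw [Function.onFun, disjoint_left]
      intro y hy hy'
      exact hxx' ((hCfib x y hy).symm.trans (hCfib x' y hy'))
  -- (4) the wall for Λ_i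
  intro y
  funext i
  set Λ : (Fin (a + 2) → Bool) → Bool := fun y => φ y i ^^ φ (bxor y w) i with hΛ
  have hΛdeg : IsDegLeFun 1 Λ := stub_derivDegree _ 1 (fun y => φ y i) w (hφ i)
  have hΛU : ∀ y ∈ U, Λ y = false := by
    intro y hy
    rw [hU, mem_biUnion] at hy
    obtain ⟨x, -, hyC⟩ := hy
    obtain ⟨p, q, σ, τ, hpq, rfl⟩ := (mem_filter.1 hyC).2
    simp only [hΛ, hΛcorner x p q hpq σ τ, Bool.xor_self]
  by_contra hne
  have hyΛ : Λ y = true := by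
    simp only [hΛ]
    revert hne
    cases φ (bxor y w) i <;> cases φ y i <;> simp
  have key := stub_rmWeight stub_derivDegree (a + 2) 1 Λ hΛdeg ⟨y, hyΛ⟩
  have hsub : (univ.filter fun y => Λ y = true) ⊆ univ \ U := by
    intro y' hy'
    rw [mem_sdiff]
    refine ⟨mem_univ _, fun hU' => ?_⟩
    have := hΛU y' hU'
    rw [(mem_filter.1 hy').2] at this
    exact Bool.noConfusion this
  have hc1 := card_le_card hsub
  rw [card_univ_sdiff, Fintype.card_fun, Fintype.card_bool, Fintype.card_fin] at hc1
  rw [pow_one] at key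
  have hZle : Z.card ≤ 2 ^ a := by
    have := card_filter_le (univ : Finset (Fin a → Bool)) (fun x₁ : Fin a → Bool => ∀ i j, B x₁ i j = false)
    rwa [card_univ, Fintype.card_fun, Fintype.card_bool, Fintype.card_fin] at this
  have hU' : U.card ≤ 2 ^ (a + 2) := by
    have := card_le_univ U
    rwa [Fintype.card_fun, Fintype.card_bool, Fintype.card_fin] at this
  have h2a : 2 ^ (a + 2) = 4 * 2 ^ a := by ring
  omega

/-- Registered helper-stub form (see the module docstring). [folklore] -/
theorem acz_sumFibrewiseStub : ∀ {a : ℕ} (f : (Fin (a + (a + 2)) → Bool) → Bool) (φ : (Fin (a + 2) → Bool) → (Fin a → Bool)) (h : (Fin (a + 2) → Bool) → Bool), ∑ y : Fin (a + 2) → Bool, signOf (h y) * W (fun x₂ => signOf (f (Fin.append (φ y) x₂))) y = ∑ x₁ : Fin a → Bool, ∑ y ∈ univ.filter (fun y : Fin (a + 2) → Bool => φ y = x₁), signOf (h y) * W (fun x₂ => signOf (f (Fin.append x₁ x₂))) y := by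
  intro a f φ h
  exact acz_sum_fibrewise f φ h

end Summit.QuantumAdvantage.QuantumAdvantage.Theorems.CubicForrelation.NearExactIsExact

end
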